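import Summits.ResolutionOfSingularities.ResolutionOfSingularities.Theorems.FrobeniusLadderFInjectiveMacaulayficationPencilFedderTrinomial
import Summits.ResolutionOfSingularities.ResolutionOfSingularities.Theorems.FrobeniusLadderFInjectiveMacaulayficationChartPointParameters
import HarnessLib

/-!
# The per-code Fedder facts of the pencil charts over a regular base, in regular-system-of-parameters form
# (BED Ω₁ GLOBAL PATCH, F6 v2 §2 / NOTES «per-code recipes»: T1a / code 1, codes 2 and 4, code 5 — the inputs `(u w₀ − v)^(p−1) ∉ 𝔪^[p]`, `(v w₁ − u)^(p−1) ∉ 𝔪^[p]`,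
# `u^(p−1) ∉ 𝔪^[p]`, `v^(p−1) ∉ 𝔪^[p]` of ✓ `PencilFedderRegularBase`; crux `FInjectiveMacaulayfication` stmt-ResolutionOfSingularities-15315, chain w45a; seat res-L1-w45a-stub-3 g15)

[OURS · L1 W4.5a] Support file (`--supports stmt-ResolutionOfSingularities-15315 --as helper`); theorems only; GENERIC commutative algebra; no named fact; NOT a statement of any
manuscript; nothing of the crux is proved. AI-written (AI review is weaker than expert review).

`(R, 𝔪)` regular local of characteristic `p`, `s` a regular system of parameters (list), monomials `∏ s[i]^(e i)`.
* `sumMonomials_mul_mem_frobeniusPower` — a sum of multiples of monomials each having a letter outside `supp e`, times `∏ s[i]^(k·e i) · ∏ s[i]^((p−1)(1 − e i))`, lies in `𝔪^[p]`;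
* ★★ `sumMonomials_add_pow_not_mem` — `(x + β·∏ s[i]^(e i))^(p−1) ∉ 𝔪^[p]` for `β` a unit, `e ≤ 1`, `x` such a sum (T1a `(u w₀ − v)`, `(v w₁ − u)`; codes 2/4 at the unit points of the `U`-chart);
* ★★ `sumMonomials_add_add_pow_not_mem` — the same with a third term `γ·∏ s[i]^(c i)` dominated in the sense `∃ i′, e i′ < c i′` (code 5: `(u w₀ − v)`, `(v w₁ − u)`, `v`);
* `not_mem_sq_of_cons_rsop` — a member of a regular system of parameters is not in `𝔪²` (the `(W-a)` branch via ✓ `pow_sub_one_not_mem_frobeniusPower_of_not_mem_sq`).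
[cite: Fedder1983, Prop. 1.7; Matsumura1987, Thm. 14.2]
-/

set_option linter.dupNamespace false

namespace Summit.ResolutionOfSingularities.ResolutionOfSingularities.Theorems.FInjectiveMacaulayfication.PencilCodeFedder

open IsLocalRing Literature.RingTheory.TightClosure Literature.AlgebraicGeometry.Resolution
open Summit.ResolutionOfSingularities.ResolutionOfSingularities.Theorems.FInjectiveMacaulayfication SopFrobeniusPower PencilFedderTrinomial

universe u

variable (p : ℕ) [Fact p.Prime] {R : Type u} [CommRing R]

/-! ## §1 Sums of dominated monomials -/

omit [Fact p.Prime] in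
/-- A sum of multiples of monomials `∏ s[i]^(f i)`, each with a letter `i` where `f i ≠ 0 = e i`, multiplied by `∏ s[i]^(k·e i) · ∏ s[i]^((p−1)(1−e i))` and anything else, lies in `𝔪^[p]`
(at that letter the exponent is `f i + (p − 1) ≥ p`; needs `p ≥ 1`). [cite: Fedder1983, Prop. 1.7] -/
theorem sumMonomials_mul_mem_frobeniusPower [IsLocalRing R] [CharP R p] (hp : 1 ≤ p) (s : List R) (hspan : Ideal.ofList s = maximalIdeal R)
    (e : ℕ → ℕ) (L : List (R × (ℕ → ℕ))) (hL : ∀ q ∈ L, ∃ i : Fin s.length, q.2 i ≠ 0 ∧ e i = 0) (k : ℕ) (t : R) :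
    (L.map fun q : R × (ℕ → ℕ) => q.1 * ∏ i : Fin s.length, s[i] ^ q.2 i).sum *
        ((∏ i : Fin s.length, s[i] ^ (k * e i)) * ∏ i : Fin s.length, s[i] ^ ((p - 1) * (1 - e i))) * t ∈ frobeniusPower p (maximalIdeal R) := by
  refine Ideal.mul_mem_right _ _ ?_
  rw [← List.sum_map_mul_right]
  refine list_sum_mem fun x hx => ?_
  obtain ⟨q, hq, rfl⟩ := List.mem_map.mp hx
  obtain ⟨i₀, hi₀, hei₀⟩ := hL q hq
  rw [mul_assoc, prod_pow_mul_prod_pow s (fun i => k * e i) (fun i => (p - 1) * (1 - e i)),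
    prod_pow_mul_prod_pow s q.2 (fun i => k * e i + (p - 1) * (1 - e i))]
  refine mul_monomial_mem_frobeniusPower_of_le p s hspan (fun i => q.2 i + (k * e i + (p - 1) * (1 - e i))) i₀ ?_ q.1
  have : 1 ≤ q.2 i₀ := Nat.one_le_iff_ne_zero.mpr hi₀
  show p ≤ q.2 i₀ + (k * e i₀ + (p - 1) * (1 - e i₀))
  rw [hei₀]; omega

/-! ## §2 ★★ The two master facts -/

section Regular

variable [IsRegularLocalRing R] [CharP R p]

/-- ★★ **`(x + β·∏ s[i]^(e i))^(p−1) ∉ 𝔪^[p]`** for `β` a unit, `e ≤ 1`, and `x` a sum of multiples of monomials each having a letter outside `supp e`. Instances: T1a/code 1 `(u w₀ − v)` with `v` the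
unit-monomial; T1a and code 2 at the unit points of the `U`-chart `(v w₁ − u)`; code 4 there (`v` a binomial). [cite: Fedder1983, Prop. 1.7] -/
theorem sumMonomials_add_pow_not_mem (s : List R) (hspan : Ideal.ofList s = maximalIdeal R) (hlen : (s.length : WithBot ℕ∞) = ringKrullDim R)
    (e : ℕ → ℕ) (he : ∀ i, e i ≤ 1) (β : R) (hβ : IsUnit β) (y : R) (hy : y = β * ∏ i : Fin s.length, s[i] ^ e i)
    (L : List (R × (ℕ → ℕ))) (hL : ∀ q ∈ L, ∃ i : Fin s.length, q.2 i ≠ 0 ∧ e i = 0) (x : R) (hx : x = (L.map fun q : R × (ℕ → ℕ) => q.1 * ∏ i : Fin s.length, s[i] ^ q.2 i).sum) :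
    (x + y) ^ (p - 1) ∉ frobeniusPower p (maximalIdeal R) := by
  refine binomial_pow_not_mem_frobeniusPower p s hspan hlen x y β e he hβ hy fun j k hjk hj => ?_
  obtain ⟨j', rfl⟩ : ∃ j', j = j' + 1 := ⟨j - 1, (Nat.succ_pred_eq_of_ne_zero hj).symm⟩
  have hyk : y ^ k = β ^ k * ∏ i : Fin s.length, s[i] ^ (k * e i) := by rw [hy, mul_pow, prod_pow_pow]
  have : x ^ (j' + 1) * y ^ k * ∏ i : Fin s.length, s[i] ^ ((p - 1) * (1 - e i)) =
      x * ((∏ i : Fin s.length, s[i] ^ (k * e i)) * ∏ i : Fin s.length, s[i] ^ ((p - 1) * (1 - e i))) * (x ^ j' * β ^ k) := by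
    rw [pow_succ, hyk]; ring
  rw [this, hx]
  exact sumMonomials_mul_mem_frobeniusPower p (Fact.out : p.Prime).one_lt.le s hspan e L hL k _

/-- ★★ **`(x + β·∏ s[i]^(e i) + γ·∏ s[i]^(c i))^(p−1) ∉ 𝔪^[p]`** for `β` a unit, `e ≤ 1`, `x` a sum of dominated monomials as above, and a third monomial with `e i′ < c i′` at some letter.
Instances: code 5 `(u w₀ − v)`, `(v w₁ − u)`, `v` (`v = β·Y^{m+b} + γ·Y^{m+c}`). [cite: Fedder1983, Prop. 1.7] -/
theorem sumMonomials_add_add_pow_not_mem (s : List R) (hspan : Ideal.ofList s = maximalIdeal R) (hlen : (s.length : WithBot ℕ∞) = ringKrullDim R)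
    (e : ℕ → ℕ) (he : ∀ i, e i ≤ 1) (β : R) (hβ : IsUnit β) (y : R) (hy : y = β * ∏ i : Fin s.length, s[i] ^ e i)
    (L : List (R × (ℕ → ℕ))) (hL : ∀ q ∈ L, ∃ i : Fin s.length, q.2 i ≠ 0 ∧ e i = 0) (x : R) (hx : x = (L.map fun q : R × (ℕ → ℕ) => q.1 * ∏ i : Fin s.length, s[i] ^ q.2 i).sum)
    (c : ℕ → ℕ) (γ : R) (z : R) (hz : z = γ * ∏ i : Fin s.length, s[i] ^ c i) (hc : ∃ i' : Fin s.length, e i' < c i') :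
    (x + y + z) ^ (p - 1) ∉ frobeniusPower p (maximalIdeal R) := by
  refine trinomial_pow_not_mem_frobeniusPower p s hspan hlen x y z β e he hβ hy fun j k l hjkl hjl => ?_
  have hyk : y ^ k = β ^ k * ∏ i : Fin s.length, s[i] ^ (k * e i) := by rw [hy, mul_pow, prod_pow_pow]
  rcases Nat.eq_zero_or_pos j with rfl | hj
  · -- `j = 0`, `l ≥ 1`: overflow at the letter where `c` dominates `e`
    have hl : l ≠ 0 := hjl.resolve_left (fun h => h rfl)
    obtain ⟨i', hi'⟩ := hc
    have hzl : z ^ l = γ ^ l * ∏ i : Fin s.length, s[i] ^ (l * c i) := by rw [hz, mul_pow, prod_pow_pow]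
    rw [pow_zero, one_mul, hyk, hzl]
    have : β ^ k * (∏ i : Fin s.length, s[i] ^ (k * e i)) * (γ ^ l * ∏ i : Fin s.length, s[i] ^ (l * c i)) * ∏ i : Fin s.length, s[i] ^ ((p - 1) * (1 - e i)) =
        (β ^ k * γ ^ l) * ((∏ i : Fin s.length, s[i] ^ (k * e i)) * (∏ i : Fin s.length, s[i] ^ (l * c i)) * ∏ i : Fin s.length, s[i] ^ ((p - 1) * (1 - e i))) := by ring
    rw [this, prod_pow_mul_prod_pow s (fun i => k * e i) (fun i => l * c i), prod_pow_mul_prod_pow s (fun i => k * e i + l * c i) (fun i => (p - 1) * (1 - e i))]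
    refine mul_monomial_mem_frobeniusPower_of_le p s hspan (fun i => k * e i + l * c i + (p - 1) * (1 - e i)) i' ?_ _
    show p ≤ k * e i' + l * c i' + (p - 1) * (1 - e i')
    have hl1 : 1 ≤ l := Nat.one_le_iff_ne_zero.mpr hl
    have hp1 : 1 ≤ p - 1 := by have := (Fact.out : p.Prime).two_le; omega
    rcases Nat.le_one_iff_eq_zero_or_eq_one.mp (he i') with h0 | h1
    · rw [h0] at hi' ⊢
      have : l * 1 ≤ l * c i' := Nat.mul_le_mul_left l hi'
      simp only [mul_zero, zero_add, Nat.sub_zero, mul_one] at this ⊢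
      omega
    · rw [h1] at hi' ⊢
      have : l * 2 ≤ l * c i' := Nat.mul_le_mul_left l hi'
      simp only [mul_one, Nat.sub_self, mul_zero, add_zero]
      omega
  · -- `j ≥ 1`: the `x`-factor overflows
    obtain ⟨j', rfl⟩ : ∃ j', j = j' + 1 := ⟨j - 1, (Nat.succ_pred_eq_of_ne_zero hj.ne').symm⟩
    have : x ^ (j' + 1) * y ^ k * z ^ l * ∏ i : Fin s.length, s[i] ^ ((p - 1) * (1 - e i)) =
        x * ((∏ i : Fin s.length, s[i] ^ (k * e i)) * ∏ i : Fin s.length, s[i] ^ ((p - 1) * (1 - e i))) * (x ^ j' * β ^ k * z ^ l) := by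
      rw [pow_succ, hyk]; ring
    rw [this, hx]
    exact sumMonomials_mul_mem_frobeniusPower p (Fact.out : p.Prime).one_lt.le s hspan e L hL k _

/-! ## §3 Members of a regular system of parameters -/

omit [CharP R p] in
/-- A member of a regular system of parameters does not lie in `𝔪²`. [cite: Matsumura1987, Thm. 14.2] -/
theorem not_mem_sq_of_cons_rsop (x : R) (t : List R) (hspan : Ideal.ofList (x :: t) = maximalIdeal R) (hlen : ((x :: t).length : WithBot ℕ∞) = ringKrullDim R) :
    x ∉ maximalIdeal R ^ 2 := by
  intro hx
  have h := ChartPointParameters.ofList_eq_of_mem_sup_sq x t hspan (Ideal.mem_sup_right hx)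
  have hxm : x ∈ maximalIdeal R := Ideal.pow_le_self two_ne_zero hx
  rw [← h] at hxm
  exact head_not_mem_ofList_tail x t hspan hlen hxm

end Regular

end Summit.ResolutionOfSingularities.ResolutionOfSingularities.Theorems.FInjectiveMacaulayfication.PencilCodeFedder
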